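import Summits.Ventures.YMGap.RobustBall.RobustStarDoorZd
import Summits.Ventures.YMGap.RobustBall.TorusRowsSU2Star
import Summits.Ventures.YMGap.RobustBall.BallClosureZdG
import Summits.Ventures.YMGap.RobustBall.UniformMassGapZdG
import HarnessLib

/-!
# Venture YMGap, track ROBUST-BALL (Y2) — THE UNIFORM STAR WINDOW BOUND ALONG THE LINES OF THE GAUGE-INVARIANT BALL, `SU(2)` ON `ℤ³`, EVERY
# `0 ≤ β_W ≤ 1/2`

HONEST FRAMING. WHAT THIS IS: a venture file (cell `pub-ymgap`, track Y2 ROBUST-BALL, seat rb-p1, theorems only): the `ℤ³` twin of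
`StateDerivativeStarCells.su2_starWindowBound_line_upTo_oneThird`, split out of `StarCellsDim3` so that every `ℤ³` star cell (the `C¹/C²` cells of
`StarCellsDim3` and the `C^∞` cells of `SmoothStarCellsDim3`) imports one light file.  The `ℤ³` certificate is the cell's `upTo 1/2` star certificate
(radii `(17/500, 17/1000)`, received sum `≤ 199/200`, star radius `max R 1 + 2`; `TorusRowsSU2Star.su2_quarterModulus`,
`RobustStarDoorZd.starWindowBoundZdR_of_memBallZdG`):
* `su2_dim3_starWindowBound_line_upTo_oneHalf` — for `(W, supp) ∈ MemBallZdG ε₀ ε₁ R`, `(V, suppV) ∈ MemBallZdG ε₀V ε₁V R_V`, `ε₀ + s₀ε₀V ≤ 17/500`,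
  `ε₁ + s₀ε₁V ≤ 17/1000`, every `0 ≤ β_W ≤ 1/2`, every `T` and `|s| ≤ s₀`: `StarWindowBoundZdR 3 2 (perturbedYM … (W + s·𝟙_T V) …) (max (max R R_V) 1 + 2)
  (199/200)`.
WHAT THIS IS NOT: anything beyond the certificate bookkeeping; lattice strong coupling; nothing continuum / Clay.
-/

noncomputable section

open MeasureTheory ProbabilityTheory Function Finset Real Filter Topology
open scoped NNReal
open Literature.Probability.LatticeModels
open Literature.Probability.LatticeModels.DobrushinMetric
open Literature.MathematicalPhysics.QuantumLattice
open Literature.MathematicalPhysics.QuantumFieldTheory hiding ZdEdge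
open Literature.MathematicalPhysics.QuantumFieldTheory.Balaban1983to89.StrongCouplingDobrushinWindow (OneLinkKRModulus)
open Summit.Ventures.YMGap.DSWindowZd
open Summit.Ventures.YMGap.StarResolventDim (gaugeR doorPoly Delta)

namespace Summit.Ventures.YMGap.RobustBall

variable {W V : Potential (ZdEdge 3) (SUN 2)} {supp suppV : Finset (ZdEdge 3) → Finset (Finset (ZdEdge 3))}

/-- **The uniform star window bound along the lines, `SU(2)`, `ℤ³`, `0 ≤ β_W ≤ 1/2`** (certificate `upTo 1/2` on `ℤ³`: radii `(17/500, 17/1000)`,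
received sum `≤ 199/200`). -/
theorem su2_dim3_starWindowBound_line_upTo_oneHalf {βW ε₀ ε₁ ε₀V ε₁V s₀ : ℝ} {R RV : ℕ} (h0 : 0 ≤ βW) (h12 : βW ≤ 1 / 2)
    (hW : MemBallZdG ε₀ ε₁ R W supp) (hV : MemBallZdG ε₀V ε₁V RV V suppV) (h₀V : 0 ≤ ε₀V) (h₁V : 0 ≤ ε₁V)
    (ha₀ : ε₀ + s₀ * ε₀V ≤ 17 / 500) (ha₁ : ε₁ + s₀ * ε₁V ≤ 17 / 1000) (T : Set (Finset (ZdEdge 3))) {s : ℝ} (hs : |s| ≤ s₀) :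
    StarWindowBoundZdR 3 2 (perturbedYM (d := 3) (fundamentalRep (Fin 2)) (2 * (βW / 4)) (W + s • T.indicator V)
      (fun Λ => supp Λ ∪ suppV Λ)) (max (max R RV) 1 + 2) (199 / 200) suFrobDist := by
  have hmem : MemBallZdG (17 / 500) (17 / 1000) (max R RV) (W + s • T.indicator V) (fun Λ => supp Λ ∪ suppV Λ) :=
    hW.add_smul_indicator hV h₀V h₁V ha₀ ha₁ hs T
  have habs : |((2 : ℕ) : ℝ) * (βW / 4)| / ((2 : ℕ) : ℝ) = βW / 4 := by
    rw [abs_of_nonneg (by positivity)]; push_cast; ring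
  have hR : |((2 : ℕ) : ℝ) * (βW / 4)| / ((2 : ℕ) : ℝ) * (2 * (((3 : ℕ) : ℝ) - 1)) ≤ 3 * βW / 2 := by
    rw [habs]; push_cast; nlinarith
  have hc' : (1 : ℝ) * Real.exp (17 / 500) * (1 + 2 * Real.sqrt ((2 : ℕ) : ℝ) * (17 / 1000)) *
      (|((2 : ℕ) : ℝ) * (βW / 4)| / ((2 : ℕ) : ℝ)) ≤ 67771 / 500000 := by
    have h2 : Real.sqrt ((2 : ℕ) : ℝ) = Real.sqrt 2 := by norm_num
    rw [h2, one_mul, habs]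
    have hb : 0 ≤ βW / 4 := by positivity
    calc Real.exp (17 / 500) * (1 + 2 * Real.sqrt 2 * (17 / 1000)) * (βW / 4)
        ≤ 206917 / 200000 * (1 + 2 * 1.41422 * (17 / 1000)) * ((1 / 2) / 4) := by
          gcongr
          · exact exp_le_17_500_star
          · exact sqrt_two_le
      _ ≤ 67771 / 500000 := by norm_num
  have hlam' : Real.sqrt ((2 : ℕ) : ℝ) * (17 / 1000 : ℝ) ≤ 12021 / 500000 := by
    have h2 : Real.sqrt ((2 : ℕ) : ℝ) = Real.sqrt 2 := by norm_num
    rw [h2]; nlinarith [sqrt_two_le, Real.sqrt_nonneg 2]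
  have h := (starWindowBoundZdR_of_memBallZdG (d := 3) (N := 2) (by norm_num) (by norm_num) zero_le_one hR
    (su2_quarterModulus (h12.trans (by norm_num))) (by norm_num) hc' hlam' (θ := 4 * (67771 / 500000) + 12021 / 500000)
    (by push_cast; ring) (by norm_num) (by unfold doorPoly; norm_num) (Kn := 20)
    (ρ := gaugeR 3 (67771 / 500000) + (12021 / 500000 + (4 * (67771 / 500000) + 12021 / 500000) ^ 20 * (4 * 3 * (12021 / 500000))) /
      (1 - (4 * (67771 / 500000) + 12021 / 500000))) (by push_cast; ring) hmem).mono_rho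
    (show _ ≤ (199 / 200 : ℝ) by unfold gaugeR Delta; norm_num)
  exact_mod_cast h

end Summit.Ventures.YMGap.RobustBall

end
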